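import Literature.NumberTheory.EllipticCurves.Gamma0CocycleDegeneracyMaps
import HarnessLib

/-!
# The degeneracy pull-backs commute with the Hecke operators away from the level on `Hom(Γ₀(·), R)`:
# `T_ℓ ∘ π_d^* = π_d^* ∘ T_ℓ` for `ℓ ∤ L` (Diamond–Shurman Prop. 5.6.2, first diagram, in group cohomology)

For `M d ∣ L`, a prime `ℓ ∤ L` and a degree-`0` cocycle `u ∈ Z¹(Γ₀(M), R) = Hom(Γ₀(M), R)`
(`HidaCohomology.cocycles 0 M R`), the pull-back `π_d^* u = u ∘ (γ ↦ diag(d,1) γ diag(d,1)⁻¹)`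
(`HidaCohomology.degeneracyPullback 0 M L d R h`, file `Gamma0CocycleDegeneracyMaps`) satisfies
`T_ℓ (π_d^* u) = π_d^* (T_ℓ u)`, where `T_ℓ` is Shimura's operator (8.3.2) on cochains through the `ℓ + 1`
standard representatives `β_j = (1 j; 0 ℓ)`, `β_∞ = diag(ℓ,1)` at the respective levels
(`HidaCohomology.heckeU 0 L R hℓ`, `heckeU 0 M R hℓ`) — the cohomological form of the commutative diagram
`ι_d ∘ T = T ∘ ι_d` of Diamond–Shurman Prop. 5.6.2 ("note that the operator `T` means one thing at level
`Np⁻¹` … and something else at level `N`"), the tree's `heckeT_degeneracyMap0` on the cusp-form side.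

Proof (Shimura §8.3, independence of the representatives (8.3.3), made explicit): conjugating the level-`L`
coset identity `βᵢ γ = γ'ᵢ β_{σ(i)}` by `D = diag(d,1)` gives `D βⱼ = T^{kⱼ} β_{e(j)} D` with
`e(j) = d·j (mod ℓ)`, `kⱼ = ⌊d j/ℓ⌋`, `T = (1 1; 0 1)` (and `e(∞) = ∞`, `k_∞ = 0`), hence the LEVEL-`M` identity
`β_{e(i)} δ(γ) = (T^{-kᵢ} δ(γ'ᵢ) T^{k_{σ(i)}}) β_{e(σ(i))}`; by uniqueness of the coset decomposition at level
`M`, `σ_M(e(i)) = e(σ(i))` and `δ(γ)'_{e(i)} = T^{-kᵢ} δ(γ'ᵢ) T^{k_{σ(i)}}`. Since `u` is a homomorphism and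
`i ↦ e(i)`, `i ↦ σ(i)` are bijections, the `T`-terms cancel in the sum. (For `n > 0` the two sides agree
only up to a coboundary; not treated.) Everything is proved; no named facts.

## References

* F. Diamond, J. Shurman, *A first course in modular forms*, GTM 228 (2005), Prop. 5.6.2 (p. 189, first
  diagram; Exercise 5.6.3 (a)). [cite: DiamondShurman2005, Prop. 5.6.2 (p. 189)]
* G. Shimura, *Introduction to the arithmetic theory of automorphic functions* (1971), §8.3, (8.3.2)–(8.3.3)
  (p. 237). [cite: Shimura1971, §8.3 (8.3.2)–(8.3.3)]
-/

noncomputable section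

open scoped MatrixGroups ModularForm

open CongruenceSubgroup Matrix

namespace Literature.NumberTheory.EllipticCurves.ModularForms.HidaCohomology

open Literature.NumberTheory.EllipticCurves.ModularForms

section Commute

variable {M L d ℓ : ℕ}

/-! #### Plumbing: translations, the index map `j ↦ d·j`, the shift amounts `⌊d j/ℓ⌋` -/

/-- The translation `T^k = (1 k; 0 1)` as an element of `Γ₀(M)` (plumbing). [folklore] -/
private def transl (M : ℕ) (k : ℤ) : Gamma0 M :=
  ⟨ModularGroup.T ^ k, by
    rw [Gamma0_mem]
    simp [ModularGroup.coe_T_zpow]⟩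

/-- The matrix of `transl M k` is `(1 k; 0 1)` (plumbing). [folklore] -/
private theorem gmat_transl (M : ℕ) (k : ℤ) : gmat (transl M k) = !![1, k; 0, 1] := by
  simp [gmat, transl, ModularGroup.coe_T_zpow]

/-- `gmat γ⁻¹ * gmat γ = 1` (plumbing). [folklore] -/
private theorem gmat_inv_mul' {N : ℕ} (γ : Gamma0 N) : gmat γ⁻¹ * gmat γ = 1 := by
  rw [← gmat_mul, inv_mul_cancel, gmat_one]

/-- An element of `Γ₀(N)` is determined by its integer matrix (plumbing). [folklore] -/
private theorem ext_gmat' {N : ℕ} {γ δ : Gamma0 N} (hγδ : gmat γ = gmat δ) : γ = δ :=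
  Subtype.ext (Matrix.SpecialLinearGroup.ext _ _ fun i j ↦ congrFun (congrFun hγδ i) j)

/-- The shift amount `⌊d j/ℓ⌋` of the representative `βⱼ` under conjugation by `diag(d,1)` (`0` for `β_∞`)
(plumbing). [folklore] -/
private def shiftAmt (d ℓ : ℕ) : Option (ZMod ℓ) → ℤ
  | some j => ((d * j.val / ℓ : ℕ) : ℤ)
  | none => 0

/-- The index map `j ↦ w·j`, `∞ ↦ ∞` on Hecke indices, for a unit `w` of `ℤ/ℓ` (plumbing). [folklore] -/
private def idxMap (hℓM : ¬ ℓ ∣ M) (w : (ZMod ℓ)ˣ) : HeckeIdx L ℓ → HeckeIdx M ℓ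
  | ⟨some j, _⟩ => ⟨some ((w : ZMod ℓ) * j), fun h ↦ (Option.some_ne_none _ h).elim⟩
  | ⟨none, _⟩ => ⟨none, fun _ ↦ hℓM⟩

/-- `idxMap` on a finite index (plumbing). [folklore] -/
private theorem idxMap_some (hℓM : ¬ ℓ ∣ M) (w : (ZMod ℓ)ˣ) (j : ZMod ℓ) (hj : some j = none → ¬ ℓ ∣ L) :
    (idxMap (L := L) hℓM w ⟨some j, hj⟩).1 = some ((w : ZMod ℓ) * j) := rfl

/-- `idxMap` on `∞` (plumbing). [folklore] -/
private theorem idxMap_none (hℓM : ¬ ℓ ∣ M) (w : (ZMod ℓ)ˣ) (hj : (none : Option (ZMod ℓ)) = none → ¬ ℓ ∣ L) :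
    (idxMap (L := L) hℓM w ⟨none, hj⟩).1 = none := rfl

/-- The index map as an equivalence `HeckeIdx L ℓ ≃ HeckeIdx M ℓ` (inverse: multiplication by `w⁻¹`)
(plumbing). [folklore] -/
private def idxEquiv (hℓL : ¬ ℓ ∣ L) (hℓM : ¬ ℓ ∣ M) (w : (ZMod ℓ)ˣ) : HeckeIdx L ℓ ≃ HeckeIdx M ℓ where
  toFun := idxMap hℓM w
  invFun := idxMap hℓL w⁻¹
  left_inv := by
    rintro ⟨_ | j, hj⟩
    · rfl
    · apply Subtype.ext
      show some (((w⁻¹ : (ZMod ℓ)ˣ) : ZMod ℓ) * ((w : ZMod ℓ) * j)) = some j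
      rw [← mul_assoc, Units.inv_mul, one_mul]
  right_inv := by
    rintro ⟨_ | j, hj⟩
    · rfl
    · apply Subtype.ext
      show some ((w : ZMod ℓ) * (((w⁻¹ : (ZMod ℓ)ˣ) : ZMod ℓ) * j)) = some j
      rw [← mul_assoc, Units.mul_inv, one_mul]

/-- `idxEquiv` is `idxMap` (plumbing). [folklore] -/
private theorem idxEquiv_apply (hℓL : ¬ ℓ ∣ L) (hℓM : ¬ ℓ ∣ M) (w : (ZMod ℓ)ˣ) (i : HeckeIdx L ℓ) :
    idxEquiv hℓL hℓM w i = idxMap hℓM w i := rfl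

/-- Right multiplication by `diag(d,1)` scales the first column (plumbing). [folklore] -/
private theorem mul_diag (X : Matrix (Fin 2) (Fin 2) ℤ) (d : ℕ) :
    X * !![(d : ℤ), 0; 0, 1] = !![X 0 0 * d, X 0 1; X 1 0 * d, X 1 1] := by
  ext a b
  fin_cases a <;> fin_cases b <;> simp [Matrix.mul_apply, Fin.sum_univ_two]

/-- **Conjugating the representatives by `diag(d,1)`**: `D βᵢ = T^{kᵢ} β_{e(i)} D` with `e(j) = d·j`,
`kⱼ = ⌊d j/ℓ⌋`, `e(∞) = ∞`, `k_∞ = 0` (plumbing for Shimura (8.3.3)). [folklore] -/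
private theorem diag_mul_heckeRep (hℓM : ¬ ℓ ∣ M) (hdℓ : Nat.Coprime d ℓ) (i : HeckeIdx L ℓ) :
    !![(d : ℤ), 0; 0, 1] * heckeRep ℓ i.1 =
      gmat (transl M (shiftAmt d ℓ i.1)) * heckeRep ℓ (idxMap (L := L) hℓM (ZMod.unitOfCoprime d hdℓ) i).1 *
        !![(d : ℤ), 0; 0, 1] := by
  obtain ⟨_ | j, hj⟩ := i
  · rw [gmat_transl, idxMap_none, mul_heckeRep_none, mul_heckeRep_none, mul_diag]
    ext a b
    fin_cases a <;> fin_cases b <;> simp [shiftAmt]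
    ring
  · rw [gmat_transl, idxMap_some, mul_heckeRep_some, mul_heckeRep_some, mul_diag]
    have h1 : (((ZMod.unitOfCoprime d hdℓ : (ZMod ℓ)ˣ) : ZMod ℓ) * j).val = d * j.val % ℓ := by
      rw [ZMod.val_mul, ZMod.coe_unitOfCoprime, ZMod.val_natCast, Nat.mod_mul_mod]
    have hval : (((((ZMod.unitOfCoprime d hdℓ : (ZMod ℓ)ˣ) : ZMod ℓ) * j).val : ℕ) : ℤ) +
        ((d * j.val / ℓ : ℕ) : ℤ) * ℓ = (d : ℤ) * (j.val : ℤ) := by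
      rw [h1]
      have h2 := Nat.mod_add_div (d * j.val) ℓ
      have h3 : ((d * j.val % ℓ : ℕ) : ℤ) + ((d * j.val / ℓ : ℕ) : ℤ) * ℓ =
          ((d * j.val % ℓ + ℓ * (d * j.val / ℓ) : ℕ) : ℤ) := by push_cast; ring
      rw [h3, h2]; push_cast; ring
    generalize (((((ZMod.unitOfCoprime d hdℓ : (ZMod ℓ)ˣ) : ZMod ℓ) * j).val : ℕ) : ℤ) = J at hval ⊢
    generalize ((j.val : ℕ) : ℤ) = J₀ at hval ⊢
    have hsh : shiftAmt d ℓ (some j) = ((d * j.val / ℓ : ℕ) : ℤ) := rfl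
    rw [hsh]
    generalize ((d * j.val / ℓ : ℕ) : ℤ) = K at hval ⊢
    ext a b
    fin_cases a <;> fin_cases b <;> simp
    linear_combination -hval

/-! #### The commutation `T_ℓ ∘ π_d^* = π_d^* ∘ T_ℓ` on `Hom(Γ₀(·), R)` -/

/-- **Degeneracy pull-backs commute with `T_ℓ` away from the level, on `Hom(Γ₀(·), R)`** (degree-`0` cocycles;
the cohomological form of Diamond–Shurman Prop. 5.6.2, first diagram `ι_d ∘ T = T ∘ ι_d`, with Shimura's
operator (8.3.2) on cochains): for `M d ∣ L`, a prime `ℓ ∤ L` and `u ∈ Z¹(Γ₀(M), R) = Hom(Γ₀(M), R)`,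
`T_ℓ (π_d^* u) = π_d^* (T_ℓ u)` as functions on `Γ₀(L)` — exactly, not only up to coboundaries, because in
degree `0` Shimura's ambiguity (8.3.3) is a sum of values of the homomorphism `u` at translations `T^{±k}`,
which cancels. [cite: DiamondShurman2005, Prop. 5.6.2 (p. 189)] -/
theorem heckeU_degeneracyPullback_zero [NeZero M] [NeZero L] [NeZero d] [NeZero ℓ] {R : Type*} [CommRing R]
    (h : M * d ∣ L) (hℓ : ℓ.Prime) (hℓL : ¬ ℓ ∣ L) {u : Gamma0 M → Fin 1 → R} (hu : u ∈ cocycles 0 M R) :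
    heckeU 0 L R hℓ (degeneracyPullback 0 M L d R h u) =
      degeneracyPullback 0 M L d R h (heckeU 0 M R hℓ u) := by
  have hML : M ∣ L := (dvd_mul_right M d).trans h
  have hdL : d ∣ L := (dvd_mul_left d M).trans h
  have hℓM : ¬ ℓ ∣ M := fun hd ↦ hℓL (hd.trans hML)
  have hdℓ : Nat.Coprime d ℓ :=
    Nat.coprime_comm.mp ((Nat.Prime.coprime_iff_not_dvd hℓ).mpr fun hd ↦ hℓL (hd.trans hdL))
  have hD : (!![(d : ℤ), 0; 0, 1] : Matrix (Fin 2) (Fin 2) ℤ).det ≠ 0 := by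
    rw [Matrix.det_fin_two_of]; simpa using NeZero.ne d
  -- the cocycle identities in degree `0`: `u` is a homomorphism
  have hmul : ∀ x y : Gamma0 M, u (x * y) = u y + u x := fun x y ↦ by
    have := hu x y; rwa [act_zero_eq_id, LinearMap.id_apply] at this
  have hinv : ∀ x : Gamma0 M, u x⁻¹ = -u x := fun x ↦ by
    have := cocycle_map_inv hu x; rwa [act_zero_eq_id, LinearMap.id_apply] at this
  funext γ
  simp only [heckeU_apply, degeneracyPullback_zero_apply, act_zero_eq_id, LinearMap.id_apply]
  -- the key identification of the level-`M` permutation data along `e = idxMap`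
  have key : ∀ i : HeckeIdx L ℓ,
      heckePermElt hℓ (Gamma0.degeneracyConj M L d h γ) (idxMap (L := L) hℓM (ZMod.unitOfCoprime d hdℓ) i) =
        (transl M (shiftAmt d ℓ i.1))⁻¹ * Gamma0.degeneracyConj M L d h (heckePermElt hℓ γ i) *
          transl M (shiftAmt d ℓ (heckePerm hℓ γ i).1) := by
    intro i
    set w := ZMod.unitOfCoprime d hdℓ with hw
    set c := Gamma0.degeneracyConj M L d h with hc
    set ε : Gamma0 M := (transl M (shiftAmt d ℓ i.1))⁻¹ * c (heckePermElt hℓ γ i) *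
      transl M (shiftAmt d ℓ (heckePerm hℓ γ i).1) with hε
    -- (K2) the level-`M` coset identity for `ε`
    have K2 : gmat ε * heckeRep ℓ (idxMap (L := L) hℓM w (heckePerm hℓ γ i)).1 =
        heckeRep ℓ (idxMap (L := L) hℓM w i).1 * gmat (c γ) := by
      apply matrix_mul_right_cancel_of_det_ne_zero hD
      have s1 := diag_mul_heckeRep (L := L) (M := M) hℓM hdℓ i
      have s2 := diag_mul_heckeRep (L := L) (M := M) hℓM hdℓ (heckePerm hℓ γ i)
      have sp := gmat_heckePermElt_mul hℓ γ i
      have cj1 := Gamma0.gmat_degeneracyConj_mul_diag h γ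
      have cj2 := Gamma0.gmat_degeneracyConj_mul_diag h (heckePermElt hℓ γ i)
      calc gmat ε * heckeRep ℓ (idxMap (L := L) hℓM w (heckePerm hℓ γ i)).1 * !![(d : ℤ), 0; 0, 1]
          = gmat (transl M (shiftAmt d ℓ i.1))⁻¹ * gmat (c (heckePermElt hℓ γ i)) *
              (gmat (transl M (shiftAmt d ℓ (heckePerm hℓ γ i).1)) *
                heckeRep ℓ (idxMap (L := L) hℓM w (heckePerm hℓ γ i)).1 * !![(d : ℤ), 0; 0, 1]) := by
            rw [hε, gmat_mul, gmat_mul]; simp only [Matrix.mul_assoc]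
        _ = gmat (transl M (shiftAmt d ℓ i.1))⁻¹ * gmat (c (heckePermElt hℓ γ i)) *
              (!![(d : ℤ), 0; 0, 1] * heckeRep ℓ (heckePerm hℓ γ i).1) := by rw [← s2]
        _ = gmat (transl M (shiftAmt d ℓ i.1))⁻¹ * (gmat (c (heckePermElt hℓ γ i)) * !![(d : ℤ), 0; 0, 1]) *
              heckeRep ℓ (heckePerm hℓ γ i).1 := by simp only [Matrix.mul_assoc]
        _ = gmat (transl M (shiftAmt d ℓ i.1))⁻¹ * (!![(d : ℤ), 0; 0, 1] * gmat (heckePermElt hℓ γ i)) *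
              heckeRep ℓ (heckePerm hℓ γ i).1 := by rw [hc, cj2]
        _ = gmat (transl M (shiftAmt d ℓ i.1))⁻¹ * !![(d : ℤ), 0; 0, 1] *
              (gmat (heckePermElt hℓ γ i) * heckeRep ℓ (heckePerm hℓ γ i).1) := by
            simp only [Matrix.mul_assoc]
        _ = gmat (transl M (shiftAmt d ℓ i.1))⁻¹ * !![(d : ℤ), 0; 0, 1] * (heckeRep ℓ i.1 * gmat γ) := by
            rw [sp]
        _ = gmat (transl M (shiftAmt d ℓ i.1))⁻¹ * (!![(d : ℤ), 0; 0, 1] * heckeRep ℓ i.1) * gmat γ := by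
            simp only [Matrix.mul_assoc]
        _ = gmat (transl M (shiftAmt d ℓ i.1))⁻¹ *
              (gmat (transl M (shiftAmt d ℓ i.1)) * heckeRep ℓ (idxMap (L := L) hℓM w i).1 *
                !![(d : ℤ), 0; 0, 1]) * gmat γ := by rw [s1]
        _ = gmat (transl M (shiftAmt d ℓ i.1))⁻¹ * gmat (transl M (shiftAmt d ℓ i.1)) *
              heckeRep ℓ (idxMap (L := L) hℓM w i).1 * (!![(d : ℤ), 0; 0, 1] * gmat γ) := by
            simp only [Matrix.mul_assoc]
        _ = heckeRep ℓ (idxMap (L := L) hℓM w i).1 * (!![(d : ℤ), 0; 0, 1] * gmat γ) := by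
            rw [gmat_inv_mul', Matrix.one_mul]
        _ = heckeRep ℓ (idxMap (L := L) hℓM w i).1 * (gmat (c γ) * !![(d : ℤ), 0; 0, 1]) := by
            rw [hc, cj1]
        _ = heckeRep ℓ (idxMap (L := L) hℓM w i).1 * gmat (c γ) * !![(d : ℤ), 0; 0, 1] := by
            simp only [Matrix.mul_assoc]
    -- (K3) the permutation at level `M` along `e`, by uniqueness of the coset decomposition
    have K3 : heckePerm hℓ (c γ) (idxMap (L := L) hℓM w i) = idxMap (L := L) hℓM w (heckePerm hℓ γ i) :=
      (existsUnique_heckeRep_mul_coe hℓ (c γ) (idxMap (L := L) hℓM w i)).unique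
        ⟨_, coe_mem_delta0_one _, gmat_heckePermElt_mul hℓ (c γ) (idxMap (L := L) hℓM w i)⟩
        ⟨_, coe_mem_delta0_one ε, K2⟩
    -- (K4) the element at level `M`
    apply ext_gmat'
    apply matrix_mul_right_cancel_of_det_ne_zero
      (det_heckeRep_ne_zero hℓ.ne_zero (idxMap (L := L) hℓM w (heckePerm hℓ γ i)).1)
    rw [K2, ← K3]
    exact gmat_heckePermElt_mul hℓ (c γ) (idxMap (L := L) hℓM w i)
  -- reindex the level-`M` sum along `e` and cancel the translation terms
  rw [← Equiv.sum_comp (idxEquiv hℓL hℓM (ZMod.unitOfCoprime d hdℓ))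
    (fun j ↦ u (heckePermElt hℓ (Gamma0.degeneracyConj M L d h γ) j))]
  simp only [idxEquiv_apply, key, hmul, hinv]
  have hσ := Equiv.sum_comp (heckePermEquiv hℓ γ) (fun i ↦ u (transl M (shiftAmt d ℓ i.1)))
  simp only [heckePermEquiv_apply] at hσ
  rw [Finset.sum_add_distrib, Finset.sum_add_distrib, Finset.sum_neg_distrib, hσ]
  abel

/-- The same commutation on the modules of cocycles: `T_ℓ ∘ π_d^* = π_d^* ∘ T_ℓ` as maps
`Z¹(Γ₀(M), R) → Z¹(Γ₀(L), R)` in degree `0`, `ℓ ∤ L` (`heckeUZ`, `degeneracyPullbackZ`).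
[cite: DiamondShurman2005, Prop. 5.6.2 (p. 189)] -/
theorem heckeUZ_degeneracyPullbackZ_zero [NeZero M] [NeZero L] [NeZero d] [NeZero ℓ] {R : Type*} [CommRing R]
    (h : M * d ∣ L) (hℓ : ℓ.Prime) (hℓL : ¬ ℓ ∣ L) (u : cocycles 0 M R) :
    heckeUZ 0 L R hℓ (degeneracyPullbackZ 0 M L d R h u) =
      degeneracyPullbackZ 0 M L d R h (heckeUZ 0 M R hℓ u) := by
  apply Subtype.ext
  simp only [coe_heckeUZ, coe_degeneracyPullbackZ]
  exact heckeU_degeneracyPullback_zero h hℓ hℓL u.2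

/-- Powers of `T_ℓ − c` commute with `π_d^*` on degree-`0` cocycles (`ℓ ∤ L`), from
`heckeUZ_degeneracyPullbackZ_zero`. [cite: DiamondShurman2005, Prop. 5.6.2 (p. 189)] -/
theorem pow_heckeUZ_sub_degeneracyPullbackZ_zero [NeZero M] [NeZero L] [NeZero d] [NeZero ℓ] {K : Type*}
    [Field K] (h : M * d ∣ L) (hℓ : ℓ.Prime) (hℓL : ¬ ℓ ∣ L) (c : K) (m : ℕ) (u : cocycles 0 M K) :
    ((heckeUZ 0 L K hℓ - c • (1 : Module.End K (cocycles 0 L K))) ^ m) (degeneracyPullbackZ 0 M L d K h u) =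
      degeneracyPullbackZ 0 M L d K h
        (((heckeUZ 0 M K hℓ - c • (1 : Module.End K (cocycles 0 M K))) ^ m) u) := by
  induction m generalizing u with
  | zero => simp
  | succ m ih =>
    rw [pow_succ, pow_succ, Module.End.mul_apply, Module.End.mul_apply]
    have step : (heckeUZ 0 L K hℓ - c • (1 : Module.End K (cocycles 0 L K)))
        (degeneracyPullbackZ 0 M L d K h u) =
        degeneracyPullbackZ 0 M L d K h ((heckeUZ 0 M K hℓ - c • (1 : Module.End K (cocycles 0 M K))) u) := by
      rw [LinearMap.sub_apply, LinearMap.sub_apply, LinearMap.smul_apply, LinearMap.smul_apply,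
        Module.End.one_apply, Module.End.one_apply, heckeUZ_degeneracyPullbackZ_zero h hℓ hℓL u, map_sub,
        map_smul]
    rw [step, ih]

/-- **Consequence for generalised eigenvectors**: `π_d^*` carries the generalised `λ(ℓ)`-eigenspace of `T_ℓ` at
level `M` into the one at level `L` (`ℓ ∤ L`); hence `IsHeckeGenEigenvector S λ` is preserved by `π_d^*`
whenever `S` contains the primes of `L`. [cite: DiamondShurman2005, Prop. 5.6.2 (p. 189)] -/
theorem isHeckeGenEigenvector_degeneracyPullbackZ [NeZero M] [NeZero L] [NeZero d] {K : Type*} [Field K]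
    (h : M * d ∣ L) {S : Finset ℕ} (hS : ∀ q : ℕ, q.Prime → q ∣ L → q ∈ S) {lam : ℕ → K}
    {u : cocycles 0 M K} (hu : IsHeckeGenEigenvector S lam u) :
    IsHeckeGenEigenvector S lam (degeneracyPullbackZ 0 M L d K h u) := by
  intro ℓ _ hℓ hℓS
  have hℓL : ¬ ℓ ∣ L := fun hd ↦ hℓS (hS ℓ hℓ hd)
  have hmem := hu ℓ hℓ hℓS
  rw [Module.End.mem_maxGenEigenspace] at hmem ⊢
  obtain ⟨k, hk⟩ := hmem
  exact ⟨k, by rw [pow_heckeUZ_sub_degeneracyPullbackZ_zero h hℓ hℓL, hk, map_zero]⟩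

end Commute

end Literature.NumberTheory.EllipticCurves.ModularForms.HidaCohomology

end
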